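import Mathlib.Analysis.SpecialFunctions.Gamma.Deligne
import Mathlib.NumberTheory.Harmonic.ZetaAsymp
import Mathlib.NumberTheory.LSeries.Nonvanishing
import Literature.NumberTheory.LFunctions.RiemannXi
import HarnessLib

/-!
# Riemann's `ξ`: discharges of the named facts of `RiemannXi.lean`

Sibling proofs file (D-0014 append protocol) for `Literature/NumberTheory/LFunctions/RiemannXi.lean`,
which records four classical statements about `ξ(s) = ½ + ½ s(s−1) Λ₀(s)` as named facts
(`def … : Prop`). All four are proved here from Mathlib:

* `Literature.riemannXi_conj_holds : riemannXi_conj` — Schwarz reflection `ξ(s̄) = conj ξ(s)`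
  (Titchmarsh 1986, §2.1). Proof: `Λ₀(s̄) = conj Λ₀(s)` (`completedRiemannZeta₀_conj`) by the
  identity theorem, from `ζ(s̄) = conj ζ(s)` (Mathlib `riemannZeta_conj`), `Γ(s̄) = conj Γ(s)` and
  `Λ₀ = ζ · Γ_ℝ + 1/s + 1/(1−s)` on `Re s > 1`.
* `Literature.im_riemannXiUpper_ofReal_holds : im_riemannXiUpper_ofReal` — `Ξ` is real on `ℝ`
  (Titchmarsh §10.1), from reflection and `ξ(1 − s) = ξ(s)`.
* `Literature.riemannXi_eq_zero_iff_holds : riemannXi_eq_zero_iff` — the zeros of `ξ` are exactly the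
  zeros of `ζ` in `0 < Re s < 1` (Titchmarsh §2.12), from `ζ = Λ/Γ_ℝ` (`s ≠ 0`), the zeros of `Γ_ℝ`
  (`Gammaℝ_eq_zero_iff`), non-vanishing on `Re s ≥ 1` (`riemannZeta_ne_zero_of_one_le_re`) and the
  functional equation.
* `Literature.NumberTheory.LFunctions.riemannHypothesis_iff_im_eq_zero_of_riemannXiUpper_eq_zero_holds` — Riemann's own form of RH
  (Riemann 1859; Titchmarsh §10.1).

Also recorded (used by `LiCriterion.lean`): `Literature.NumberTheory.LFunctions.riemannXi_eq_zero_of_nontrivial` (a nontrivial zero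
of `ζ` in Mathlib's sense — `ζ s = 0`, `s ≠ −2(n+1)`, `s ≠ 1` — is a zero of `ξ`).

## References

* E. C. Titchmarsh, *The Theory of the Riemann Zeta-Function*, 2nd ed. (rev. D. R. Heath-Brown),
  Oxford 1986, §2.1 (eqs. (2.1.12)–(2.1.13)), §2.12, §10.1.
* B. Riemann, *Ueber die Anzahl der Primzahlen unter einer gegebenen Grösse*, 1859.
-/

noncomputable section

open Complex Filter Topology Set
open scoped ComplexConjugate

namespace Literature.NumberTheory.LFunctions

/-! ## Schwarz reflection -/

/-- `Λ₀(s̄) = conj Λ₀(s)` for Mathlib's entire completed zeta `completedRiemannZeta₀`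
(Titchmarsh 1986, §2.1: `Λ` is real for real `s`). Identity theorem: `z ↦ conj Λ₀(z̄)` is entire and
agrees with `Λ₀` on `Re z > 1`, where `Λ₀ = ζ Γ_ℝ + 1/z + 1/(1 − z)` and `ζ`, `Γ_ℝ` commute with
conjugation. [cite: Titchmarsh1986, §2.1] -/
theorem completedRiemannZeta₀_conj (s : ℂ) :
    completedRiemannZeta₀ (conj s) = conj (completedRiemannZeta₀ s) := by
  have hg_an : AnalyticOnNhd ℂ (fun z ↦ conj (completedRiemannZeta₀ (conj z))) univ :=
    DifferentiableOn.analyticOnNhd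
      (fun z _ ↦ (differentiableAt_conj_conj_iff.mpr
        (differentiable_completedZeta₀ _)).differentiableWithinAt) isOpen_univ
  have key : ∀ w : ℂ, 1 < w.re →
      completedRiemannZeta₀ w = riemannZeta w * Gammaℝ w + 1 / w + 1 / (1 - w) := by
    intro w hw
    have hw0 : w ≠ 0 := fun h ↦ by rw [h] at hw; norm_num at hw
    have hG : Gammaℝ w ≠ 0 := Gammaℝ_ne_zero_of_re_pos (by linarith)
    rw [riemannZeta_def_of_ne_zero hw0, div_mul_cancel₀ _ hG, completedRiemannZeta_eq]
    ring
  have hGamma : ∀ w : ℂ, Gammaℝ (conj w) = conj (Gammaℝ w) := by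
    intro w
    rw [Gammaℝ_def, Gammaℝ_def, map_mul, ← Complex.Gamma_conj]
    congr 1
    · rw [show -conj w / 2 = conj (-w / 2) by simp [map_div₀, map_ofNat], cpow_conj _ _ (by
        rw [Complex.arg_ofReal_of_nonneg Real.pi_pos.le]; exact Real.pi_ne_zero.symm),
        Complex.conj_ofReal]
    · rw [map_div₀, map_ofNat]
  have hgz : ∀ z : ℂ, 1 < z.re →
      conj (completedRiemannZeta₀ (conj z)) = completedRiemannZeta₀ z := by
    intro z hz
    rw [key (conj z) (by simpa using hz), key z hz]
    simp only [map_add, map_mul, map_div₀, map_one, map_sub, Complex.conj_conj, riemannZeta_conj,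
      hGamma]
  have heq : EqOn (fun z ↦ conj (completedRiemannZeta₀ (conj z))) completedRiemannZeta₀ univ :=
    hg_an.eqOn_of_preconnected_of_eventuallyEq
      (differentiable_completedZeta₀.differentiableOn.analyticOnNhd isOpen_univ)
      isPreconnected_univ (mem_univ (2 : ℂ))
      (eventuallyEq_of_mem ((isOpen_lt continuous_const continuous_re).mem_nhds (by norm_num))
        hgz)
  have := heq (mem_univ (conj s))
  simp only [Complex.conj_conj] at this
  exact this.symm

/-- DISCHARGE of the named fact `riemannXi_conj` (Schwarz reflection `ξ(s̄) = conj ξ(s)`;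
Titchmarsh 1986, §2.1), from `completedRiemannZeta₀_conj`. [cite: Titchmarsh1986, §2.1] -/
theorem riemannXi_conj_holds : riemannXi_conj := by
  intro s
  simp only [riemannXi, completedRiemannZeta₀_conj, map_add, map_mul, map_div₀, map_sub, map_one,
    map_ofNat]

/-- DISCHARGE of the named fact `im_riemannXiUpper_ofReal` (`Ξ(t) ∈ ℝ` for real `t`; Titchmarsh
1986, §10.1): `conj Ξ(t) = ξ(conj(½ + it)) = ξ(½ − it) = ξ(1 − (½ + it)) = Ξ(t)`. [cite: Titchmarsh1986, §10.1] -/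
theorem im_riemannXiUpper_ofReal_holds : im_riemannXiUpper_ofReal := by
  intro t
  have h : conj (riemannXiUpper t) = riemannXiUpper t := by
    rw [riemannXiUpper, ← riemannXi_conj_holds, ← riemannXi_one_sub]
    congr 1
    simp only [map_add, map_mul, map_div₀, map_one, map_ofNat, Complex.conj_I, Complex.conj_ofReal]
    ring
  exact Complex.conj_eq_iff_im.1 h

/-! ## Zeros of `ξ` -/

/-- A nontrivial zero of `ζ` (in the sense of Mathlib's `RiemannHypothesis`: `ζ s = 0`,
`s ≠ −2(n+1)`, `s ≠ 1`) is a zero of `ξ` (Titchmarsh 1986, §2.12): `s ≠ 0` as `ζ(0) = −½`, and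
`ζ = Λ/Γ_ℝ` with `Γ_ℝ(s) = 0` only at `s = −2n`, so `Λ(s) = 0` and `ξ(s) = ½ s(s−1) Λ(s) = 0`. [cite: Titchmarsh1986, §2.12] -/
theorem riemannXi_eq_zero_of_nontrivial {s : ℂ} (hzeta : riemannZeta s = 0)
    (htriv : ¬∃ n : ℕ, s = -2 * (n + 1)) (hone : s ≠ 1) : riemannXi s = 0 := by
  have hs0 : s ≠ 0 := by
    rintro rfl
    rw [riemannZeta_zero] at hzeta
    norm_num at hzeta
  rw [riemannXi_eq_mul_completedRiemannZeta hs0 hone]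
  rw [riemannZeta_def_of_ne_zero hs0, div_eq_zero_iff] at hzeta
  rcases hzeta with hL | hG
  · simp [hL]
  · exfalso
    obtain ⟨n, hn⟩ := Gammaℝ_eq_zero_iff.1 hG
    cases n with
    | zero => exact hs0 (by simpa using hn)
    | succ m => exact htriv ⟨m, by rw [hn]; push_cast; ring⟩

/-- If `ξ(s) = 0` then `s ≠ 0, 1`, `Λ(s) = 0` and `ζ(s) = 0` (Titchmarsh 1986, §2.12). [cite: Titchmarsh1986, §2.12] -/
theorem riemannZeta_eq_zero_of_riemannXi_eq_zero {s : ℂ} (hs : riemannXi s = 0) :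
    s ≠ 0 ∧ s ≠ 1 ∧ riemannZeta s = 0 := by
  have hs0 : s ≠ 0 := by
    rintro rfl
    rw [riemannXi_zero] at hs
    norm_num at hs
  have hs1 : s ≠ 1 := by
    rintro rfl
    rw [riemannXi_one] at hs
    norm_num at hs
  refine ⟨hs0, hs1, ?_⟩
  rw [riemannXi_eq_mul_completedRiemannZeta hs0 hs1, mul_eq_zero] at hs
  rcases hs with h | h
  · exfalso
    rw [div_eq_zero_iff, mul_eq_zero] at h
    rcases h with (h | h) | h
    · exact hs0 h
    · exact hs1 (sub_eq_zero.1 h)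
    · norm_num at h
  · rw [riemannZeta_def_of_ne_zero hs0, h, zero_div]

/-- DISCHARGE of the named fact `riemannXi_eq_zero_iff` (Titchmarsh 1986, §2.12): the zeros of `ξ`
are the zeros of `ζ` with `0 < Re s < 1`. (`→`: `ζ(s) = 0` by the previous lemma, so `Re s < 1`
by non-vanishing on `Re s ≥ 1`; applied to `1 − s` via `ξ(1−s) = ξ(s)` this gives `Re s > 0`.
`←`: `Γ_ℝ(s) ≠ 0` for `Re s > 0`, so `Λ(s) = ζ(s) Γ_ℝ(s) = 0`.) [cite: Titchmarsh1986, §2.12] -/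
theorem riemannXi_eq_zero_iff_holds : riemannXi_eq_zero_iff := by
  intro s
  constructor
  · intro hs
    obtain ⟨hs0, hs1, hz⟩ := riemannZeta_eq_zero_of_riemannXi_eq_zero hs
    obtain ⟨-, -, hz'⟩ := riemannZeta_eq_zero_of_riemannXi_eq_zero
      ((riemannXi_one_sub s).trans hs)
    refine ⟨hz, ?_, ?_⟩
    · by_contra h
      refine riemannZeta_ne_zero_of_one_le_re (s := 1 - s) ?_ hz'
      simp only [sub_re, one_re]
      linarith
    · by_contra h
      exact riemannZeta_ne_zero_of_one_le_re (s := s) (by linarith) hz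
  · rintro ⟨hz, h0, h1⟩
    have hs0 : s ≠ 0 := fun h ↦ by rw [h] at h0; simp at h0
    have hs1 : s ≠ 1 := fun h ↦ by rw [h] at h1; simp at h1
    have hG : Gammaℝ s ≠ 0 := Gammaℝ_ne_zero_of_re_pos h0
    rw [riemannZeta_def_of_ne_zero hs0, div_eq_zero_iff] at hz
    rw [riemannXi_eq_mul_completedRiemannZeta hs0 hs1, hz.resolve_right hG, mul_zero]

/-- DISCHARGE of the named fact `riemannHypothesis_iff_im_eq_zero_of_riemannXiUpper_eq_zero`
(Riemann 1859; Titchmarsh 1986, §10.1): RH holds iff all zeros of `Ξ(z) = ξ(½ + iz)` are real. [cite: Titchmarsh1986, §10.1] -/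
theorem riemannHypothesis_iff_im_eq_zero_of_riemannXiUpper_eq_zero_holds :
    riemannHypothesis_iff_im_eq_zero_of_riemannXiUpper_eq_zero := by
  constructor
  · intro hRH z hz
    rw [riemannXiUpper] at hz
    obtain ⟨hzeta, h0, h1⟩ := (riemannXi_eq_zero_iff_holds _).1 hz
    have htriv : ¬∃ n : ℕ, (1 / 2 + I * z : ℂ) = -2 * (n + 1) := by
      rintro ⟨n, hn⟩
      rw [hn] at h0
      have : ((-2 : ℂ) * (n + 1)).re = -2 * (n + 1) := by simp
      rw [this] at h0
      linarith [n.cast_nonneg (α := ℝ)]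
    have hone : (1 / 2 + I * z : ℂ) ≠ 1 := fun h ↦ by
      have := congrArg Complex.re h
      rw [this] at h1
      simp at h1
    have := hRH _ hzeta htriv hone
    simp only [add_re, mul_re, I_re, I_im, zero_mul, one_mul, zero_sub] at this
    norm_num at this
    linarith
  · intro h s hzeta htriv hone
    have hxi := riemannXi_eq_zero_of_nontrivial hzeta htriv hone
    have hz : riemannXiUpper (-I * (s - 1 / 2)) = 0 := by
      rw [riemannXiUpper, ← hxi]
      congr 1
      ring_nf
      rw [Complex.I_sq]
      ring
    have := h _ hz
    simp only [mul_im, neg_re, I_re, neg_zero, zero_mul, neg_im, I_im, sub_re,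
      zero_add] at this
    norm_num at this
    linarith

end Literature.NumberTheory.LFunctions
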